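import Literature.MathematicalPhysics.QuantumFieldTheory.Balaban1983to89.B4ThmTorusPairEta
import Literature.MathematicalPhysics.QuantumFieldTheory.Balaban1983to89.B4ThmJoinFam

/-!
# `Balaban1983to89.B4ThmAlphaUniform` — [Balaban1983RegularityDecay] THEOREM p. 573, (1.9)–(1.12), IN THE PRINT'S
# QUANTIFIER ORDER «δ₀, c₀, R₀ … depending on d, M only, c₀ on α also»: `δ₀` and `R₀` chosen BEFORE the Hölder exponent
# `α`, only `c₀` (and the smallness threshold for `e`) after it — on the lattice region-pair family and on the torus
# region-pair family of the r01 lineage (the latter is NODE 00's `famE` of record for DAG node N01)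

statement-level skeleton of published theorems with citation tags; proofs where landed; nothing here is a claim about the Yang–Mills mass gap

CITATION HEADER.  T. Bałaban, *Regularity and decay of lattice Green's functions*, Commun. Math. Phys. **89** (1983)
571–597, doi:10.1007/bf01214744 [Balaban1983RegularityDecay] (cell paper B4; held text
`paper:balaban1983-cmp89-regularity-decay`, journal page = PDF page + 570; p. 573 [PDF 3] Theorem (1.9)–(1.12), p. 572
[PDF 2] (1.1)–(1.7)).  Seat `pub-ymgap-dag-p3` gen 4 (Track A, YM-PLAN §2 node N01 = [B4]; HOME
`run/shared/lean/pub/pub-ymgap/`), a count-neutral LOCATED ADDITION to the N01 dossier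
(`…Balaban1983to89.Node00.N01Dossier`): the one «typed weaker than printed» reading of N01's theorem of record besides
`rect`, recorded by both discharge-referee reads of 2026-08-25 (pub-ymgap INBOX l.8917 ref-D, l.8922 ∕ l.8924 (2) ref-C:
«print's parenthetical "δ₀, R₀ depending on d, M only, c₀ on α also" makes δ₀, R₀ α-UNIFORM, the typed `∀ α, ∃ δ₀ c₀ R₀`
does not»).  Imports: r01 g9 `B4ThmTorusPairEta` (→ r01 g8 `B4ThmRegionPairEta`: `region_pair_members`, `regionPairFam`,
`Kmod`, and the torus lifting members `valG_torus` … `dlhs19_torus`), pub-ymgap dag-p3 g2 `B4ThmJoinFam` (monotonicity of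
`Ineq19_110` ∕ `Ineq111_112` in the constants).

WHAT IS PRINTED.  p. 573 [PDF 3], verbatim: «Theorem (Proposition 2.1 of [1]). For α < 1 there exist positive
constants δ₀, c₀, R₀ independent of A, k, Ω and depending on d, M only, c₀ on α also, such that for e sufficiently small
and for an arbitrary function f : Ω → R^N, we have [(1.9)] for x, x′ ∈ Ω, and satisfying the condition
dist({x, x′}, Ω^c) ≥ R₀. Similarly [(1.10)] for x ∈ Ω, dist(x, Ω^c) ≥ R₀. If Ω ⊂ Ω₀, then for δG_k(Ω, Ω₀, A) defined by
the equality δG_k(Ω, Ω₀, A) = G_k(Ω, A) − G_k(Ω₀, A), (1.11) we have the inequalities (1.5) and (1.6) (with the same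
restrictions on x, x′) with the additional factor [(1.12)] on the right hand sides. For some simple sets Ω, e.g. for
rectangular parallelepipeds, the inequalities hold without any restrictions on the points x, x′, i.e. for all
x, x′ ∈ Ω.»  The parenthetical «depending on d, M only, c₀ on α also» fixes `δ₀` and `R₀` independently of `α`; b04's
typed `B4.ThmPrinted` and pv17's `0 ≤ α` restriction `B4Ineq111ZeroNestEta.ThmPrintedNN` quantify
`∀ α ∃ (δ₀, c₀, R₀, e₁)`, the WEAKER reading there (pv07's `B1.Prop21Uniform` types the still finer reading of the
original [Balaban1982Higgs1] Prop. 2.1 p. 610 «for e(L^kε) sufficiently small and α < 1 there exist … δ₀, c₀, R₀ …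
depending on d, a, M only, c₀ on α also», with the threshold before `α` too and without `0 ≤ α` — NOT claimed here: the
`α < 0` instances of the typed leaf are refuted at zero field, `B4Thm19ZeroBoxNegAlpha`).

WHY NOTHING NEW IS NEEDED.  The tree's PROOF of the Theorem already runs in the print's order: r01 g8's
`B4ThmRegionPairEta.region_pair_members` packages the six members as `∃ K ≥ 16, ∀ α ∈ [0,1), ∃ C > 0, ∀ (c, β), ∃ e₁ > 0,
∀ instances …` with the rate `e^{−dist/(4nK)}` and the radius `K(d+4)` both `α`-free (r01's `B4Thm19RegionUnifK` header:
«[the] cube size K … is built from the α-independent constants of Lemma 2.2 (2.17)/(2.20)/(2.21) and Lemma 2.1 only (the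
α-dependent Hölder constant of (2.16) … enters c₀ alone)»), and `thmPrintedNN_regionPairFam` sets `δ₀ := (4K)⁻¹`,
`R₀ := K(d+4) + 2`, `c₀ := √N·C(α) + 1`; only the typed TARGET re-existentialises `δ₀, R₀` after `α`.  This module re-runs
the two family-level assemblies (lattice, torus) with the quantifiers in the print's order — no new analytic estimate.

WHAT THIS MODULE PROVES (kernel, sorry-free, standard axioms).
* §1 `ThmPrintedNNUnif fam` — the print's literal quantifier order on a family of `B4.EtaSetting`s:
  `∃ δ₀ R₀ > 0, ∀ α ∈ [0,1), ∃ c₀ e₁ > 0, ∀ i, regular → bigBlocks → 0 < e ≤ e₁ → Ineq19_110 (fam i) α δ₀ c₀ R₀ ∧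
  Ineq111_112 (fam i) α δ₀ c₀ R₀` («such that for e sufficiently small» kept AFTER `α`, as printed on p. 573);
  `thmPrintedNN_of_unif : ThmPrintedNNUnif fam → ThmPrintedNN fam` (instantiate), `thmPrinted19NN_of_unif`.
* §2 **`thmPrintedNNUnif_regionPairFam : ThmPrintedNNUnif (regionPairFam F d ℓ a₋ a₊ m²₊ c β (Kmod …))`** — r01 g8's
  `thmPrintedNN_regionPairFam` with `δ₀ = (4K)⁻¹`, `R₀ = K(d+4) + 2` fixed before `α` (its proof body verbatim after the
  constants; general pairs `Ω ⊂ Ω₀` of finite unions of `K`-blocks in `ηℤ^{d+1}`, `R₀` live).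
* §3 **`thmPrintedNNUnif_torusPairFam : ThmPrintedNNUnif (torusPairFam F d ℓ a₋ a₊ m²₊ c β (Kmod …))`** — r01 g9's
  `thmPrintedNN_torusPairFam` in the same order (torus pairs `Ω ⊂ Ω₀ ⊂ T_η`; constants: the lattice family's `δ₀, R₀`,
  per `α` the lattice `e₁` and `4(d+1)c₀`); r01's typed form is recovered by `thmPrintedNN_of_unif`.  THIS IS
  NODE 00's `famE` OF RECORD for N01 (`Node00.CarriersFrame.carriers₁_groupB4`, `rfl`, at `F := θ.F`, `d := θ.D − 1`,
  `ℓ := θ.L − 1`, windows and `(c, β)` of `θ : Node00.Stage1Params`).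
* §4 `thmPrintedNNUnif_sumElim`, `thmPrintedNNUnif_of_sumElim_left ∕ _right` — the uniform form is closed under binary joins
  of families with non-negative distance ∕ norm functionals (`δ₀ = min`, `R₀ = max` before `α`; `c₀ = max`, `e₁ = min`
  after) and restricts to the summands; `thmPrintedNNUnif_latticeTorusJoin` — (lattice pairs) ⊕ (torus pairs) with one
  `(δ₀, R₀)`.
HONEST SCOPE.  Exactly that of `B4ThmRegionPairEta` ∕ `B4ThmTorusPairEta` (abelian one-parameter orthogonal flow (1.2),
component field with staircase contours, running coefficient `a_k = B1.aSeq a L k` with `a ∈ [a₋, a₊]`, `a₋ > 0`,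
masses `m² ∈ [0, m²₊]`,
`L = ℓ+1 ≥ 2`, `ℓ^∞` metrics, Euclidean site norms, `lhs19` = sup over admissible contours, `0 ≤ α < 1`, big blocks
`Kmod` = the print's `M` «defined later in this paper» p. 572, fine torus period `≥ 3`, `K ∣ P_ν`); the smallness
threshold `e₁` is NOT made `α`-uniform (print p. 573 places «for e sufficiently small» after the constants; the lineage's
`e₁` is produced after `α`).  One `def` (the `Prop` `ThmPrintedNNUnif`, a quantifier re-ordering of pv17's `ThmPrintedNN`
over b04's `EtaSetting ∕ Ineq19_110 ∕ Ineq111_112`, nothing restated); no `sorry`; axioms standard.  Count-neutral for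
YM-PLAN (typed 28∕28, discharged count unmoved; the species word on N01's conjunct 1 is the leads').  Nothing here concerns
the continuum limit, ℝ⁴, OS axioms, a mass gap or the Clay problem.
-/

namespace Literature.MathematicalPhysics.QuantumFieldTheory.Balaban1983to89.B4ThmAlphaUniform

open Literature.MathematicalPhysics.QuantumFieldTheory.Balaban1983to89
open Literature.MathematicalPhysics.QuantumFieldTheory.Balaban1983to89.B4 (EtaSetting Ineq19_110 Ineq111_112)
open Literature.MathematicalPhysics.QuantumFieldTheory.Balaban1983to89.B4Ineq111ZeroNestEta (ThmPrintedNN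
  thmPrinted19NN_of_thmPrintedNN)
open Literature.MathematicalPhysics.QuantumFieldTheory.Balaban1983to89.B4Ineq19ZeroBoxEta (ThmPrinted19NN)
open Literature.MathematicalPhysics.QuantumFieldTheory.Balaban1983to89.B4Reflection242 (blk nbrs blk_mul boxDom)
open Literature.MathematicalPhysics.QuantumFieldTheory.Balaban1983to89.B4GaugeCovariance
open Literature.MathematicalPhysics.QuantumFieldTheory.Balaban1983to89.B4ContourShift (supNorm supNorm_nonneg
  exists_supNorm_eq abs_le_supNorm)
open Literature.MathematicalPhysics.QuantumFieldTheory.Balaban1983to89.B4Lower18 (fineDom mem_fineDom IsBlockUnion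
  fineDom_isBlockUnion)
open Literature.MathematicalPhysics.QuantumFieldTheory.Balaban1983to89.B4Lower18Regular (e1 base_le_of_blk
  dotProduct_self_nonneg')
open Literature.MathematicalPhysics.QuantumFieldTheory.Balaban1983to89.B4Lemma21Region (regionOp regionDeriv siteNorm
  covDeriv fld_covDeriv_mulVec_of_not_mem fld_covDeriv_mulVec_of_mem)
open Literature.MathematicalPhysics.QuantumFieldTheory.Balaban1983to89.B4Lemma22Reduce231 (supN le_supN supN_nonneg
  siteNorm_nonneg siteNorm_zero siteNorm_smul)
open Literature.MathematicalPhysics.QuantumFieldTheory.Balaban1983to89.B4Lemma22HolderBox (IsNNChain)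
open Literature.MathematicalPhysics.QuantumFieldTheory.Balaban1983to89.B4Eq221L2FactorRegion (acBond)
open Literature.MathematicalPhysics.QuantumFieldTheory.Balaban1983to89.B4WalkRouteRegion (rpos)
open Literature.MathematicalPhysics.QuantumFieldTheory.Balaban1983to89.B4RegionCubeCarrier (incl inReg)
open Literature.MathematicalPhysics.QuantumFieldTheory.Balaban1983to89.B4Thm112BoxValue (siteNorm_le_sqrt_card_mul
  abs_apply_le_siteNorm')
open Literature.MathematicalPhysics.QuantumFieldTheory.Balaban1983to89.B4ThmRegionPairEta
open Literature.MathematicalPhysics.QuantumFieldTheory.Balaban1983to89.B4TorusRegionOp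
open Literature.MathematicalPhysics.QuantumFieldTheory.Balaban1983to89.B4TorusRegionLift
open Literature.MathematicalPhysics.QuantumFieldTheory.Balaban1983to89.B4TorusPairFam
open Literature.MathematicalPhysics.QuantumFieldTheory.Balaban1983to89.B4ThmTorusPairEta
open Literature.MathematicalPhysics.QuantumFieldTheory.Balaban1983to89.B4ThmJoinFam (ineq19_110_mono ineq111_112_mono
  regionPairFam_signs torusPairFam_signs)
open scoped Matrix

noncomputable section

/-! ## §1. The print's quantifier order: `δ₀, R₀` before `α`; `c₀` and the threshold after -/

section Unif

variable {I : Type}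

/-- **THEOREM p. 573 IN THE PRINT'S QUANTIFIER ORDER** on a family of η-lattice settings: *«For α < 1 there exist
positive constants δ₀, c₀, R₀ independent of A, k, Ω and depending on d, M only, c₀ on α also, such that for e
sufficiently small and for an arbitrary function f : Ω → R^N, we have [(1.9)–(1.12)] …»* — `δ₀, R₀` (depending on
`d, M` only) are chosen BEFORE the Hölder exponent `α ∈ [0,1)`, the constant `c₀` («on α also») and the smallness
threshold `e₁` («such that for e sufficiently small») AFTER it; then the instance.  The displays are b04's `Ineq19_110`
((1.9)–(1.10)) and `Ineq111_112` ((1.11)–(1.12)) verbatim; pv17's `ThmPrintedNN` is the same sentence with `δ₀, R₀`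
re-quantified after `α` (`thmPrintedNN_of_unif`). [cite: Balaban1983RegularityDecay, Theorem (Proposition 2.1 of [1]) (1.9)–(1.12) p.573 «depending on d, M only, c₀ on α also»] -/
def ThmPrintedNNUnif (fam : I → EtaSetting) : Prop :=
  ∃ δ₀ R₀ : ℝ, 0 < δ₀ ∧ 0 < R₀ ∧ ∀ α : ℝ, 0 ≤ α → α < 1 → ∃ c₀ e₁ : ℝ, 0 < c₀ ∧ 0 < e₁ ∧ ∀ i : I,
    (fam i).regular → (fam i).bigBlocks → 0 < (fam i).e → (fam i).e ≤ e₁ →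
      Ineq19_110 (fam i) α δ₀ c₀ R₀ ∧ Ineq111_112 (fam i) α δ₀ c₀ R₀

/-- the print's order implies pv17's typed form `ThmPrintedNN` (instantiate the `α`-uniform `δ₀, R₀`). [cite: Balaban1983RegularityDecay, Theorem p.573 (quantifier bookkeeping)] -/
theorem thmPrintedNN_of_unif (fam : I → EtaSetting) (h : ThmPrintedNNUnif fam) : ThmPrintedNN fam := by
  obtain ⟨δ₀, R₀, hδ, hR, H⟩ := h
  intro α hα0 hα1
  obtain ⟨c₀, e₁, hc, he, H'⟩ := H α hα0 hα1
  exact ⟨δ₀, c₀, R₀, e₁, hδ, hc, hR, he, H'⟩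

/-- … hence also p17's (1.9)–(1.10) half `ThmPrinted19NN`. [cite: Balaban1983RegularityDecay, Theorem (1.9)–(1.10) p.573 (quantifier bookkeeping)] -/
theorem thmPrinted19NN_of_unif (fam : I → EtaSetting) (h : ThmPrintedNNUnif fam) : ThmPrinted19NN fam :=
  thmPrinted19NN_of_thmPrintedNN fam (thmPrintedNN_of_unif fam h)

/-- the uniform form, unfolded (`Iff.rfl`; for readers and for `rw`). [cite: Balaban1983RegularityDecay, Theorem p.573 (quantifier bookkeeping)] -/
theorem thmPrintedNNUnif_iff (fam : I → EtaSetting) :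
    ThmPrintedNNUnif fam ↔ ∃ δ₀ R₀ : ℝ, 0 < δ₀ ∧ 0 < R₀ ∧ ∀ α : ℝ, 0 ≤ α → α < 1 → ∃ c₀ e₁ : ℝ, 0 < c₀ ∧ 0 < e₁ ∧
      ∀ i : I, (fam i).regular → (fam i).bigBlocks → 0 < (fam i).e → (fam i).e ≤ e₁ →
        Ineq19_110 (fam i) α δ₀ c₀ R₀ ∧ Ineq111_112 (fam i) α δ₀ c₀ R₀ :=
  Iff.rfl

end Unif

variable {ι : Type} [Fintype ι] [DecidableEq ι]

/-! ## §2. The lattice region-pair family: r01's assembly with `δ₀ = (4K)⁻¹`, `R₀ = K(d+4)+2` fixed before `α` -/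

/-- **THEOREM p. 573 IN THE PRINT'S QUANTIFIER ORDER ON THE FAMILY OF GENERAL PAIRS `Ω ⊂ Ω₀` OF FINITE UNIONS OF BIG
BLOCKS AT A (1.7)-REGULAR FIELD** (`regionPairFam`, block size `K = Kmod`, `R₀` restriction live): there are
`δ₀ = (4K)⁻¹ > 0` and `R₀ = K(d+4) + 2 > 0` — depending on the block size and `d` only — such that for every
`0 ≤ α < 1` there are `c₀, e₁ > 0` with (1.9)–(1.10) for `G_k(Ω,A)` and (1.9)–(1.10)×(1.12) for `δG_k(Ω,Ω₀,A)` at every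
instance whose field is (1.7)-regular on `Ω₀`, whose `Ω ⊂ Ω₀` are unions of `K`-blocks and whose coupling is
`0 < e ≤ e₁`.  Proof = r01 g8's `thmPrintedNN_regionPairFam` with the constants fixed before `α`
(`region_pair_members` already quantifies `∃ K ∀ α ∃ C ∀ (c,β) ∃ e₁`). [cite: Balaban1983RegularityDecay, Theorem (1.9)–(1.12) p.573 «constants δ₀, c₀, R₀ independent of A, k, Ω and depending on d, M only, c₀ on α also»] -/
theorem thmPrintedNNUnif_regionPairFam (F : OrthFlow ι) {ℓ₁ : ℝ} (hℓ₁ : 0 ≤ ℓ₁)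
    (hLip : ∀ t (v : ι → ℝ), ((F.U t - 1) *ᵥ v) ⬝ᵥ ((F.U t - 1) *ᵥ v) ≤ (ℓ₁ * t) ^ 2 * (v ⬝ᵥ v))
    (d ℓ : ℕ) (hℓ : 1 ≤ ℓ) (amin aplus m2plus : ℝ) (ha : 0 < amin) (creg β : ℝ) (hcreg : 0 ≤ creg)
    (hβ : 0 < β) :
    ThmPrintedNNUnif
      (regionPairFam F d ℓ amin aplus m2plus creg β (Kmod F hℓ₁ hLip d ℓ hℓ amin aplus m2plus ha)) := by
  unfold ThmPrintedNNUnif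
  classical
  obtain ⟨hK16, HC⟩ := Classical.choose_spec (region_pair_members F hℓ₁ hLip d ℓ hℓ amin aplus m2plus ha)
  set K : ℕ := Kmod F hℓ₁ hLip d ℓ hℓ amin aplus m2plus ha with hKdef
  have hKeq : Classical.choose (region_pair_members F hℓ₁ hLip d ℓ hℓ amin aplus m2plus ha) = K := rfl
  rw [hKeq] at hK16 HC
  have hKr : (0 : ℝ) < K := by exact_mod_cast lt_of_lt_of_le (by norm_num) hK16
  set N2 : ℝ := Real.sqrt (Fintype.card ι) with hN2
  have hN2 : 0 ≤ N2 := Real.sqrt_nonneg _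
  set δ₀ : ℝ := 1 / (4 * K) with hδ₀
  have hδ₀0 : 0 < δ₀ := by positivity
  set R₀ : ℝ := (K : ℝ) * ((d : ℝ) + 4) + 2 with hR₀
  have hR₀0 : 0 < R₀ := by positivity
  refine ⟨δ₀, R₀, hδ₀0, hR₀0, fun α hα0 hα1 => ?_⟩
  obtain ⟨C, hC, HC'⟩ := HC α hα0 hα1
  obtain ⟨e₁, he₁, H⟩ := HC' creg β hcreg hβ
  set c₀ : ℝ := N2 * C + 1 with hc₀
  have hc₀0 : 0 < c₀ := by positivity
  have hNC : N2 * C ≤ c₀ := by rw [hc₀]; linarith only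
  refine ⟨c₀, e₁, hc₀0, he₁, ?_⟩
  intro i hreg hbig he hle
  dsimp only [regionPairFam] at hreg hbig he hle
  obtain ⟨hΩ₀, hΩ⟩ := hbig
  obtain ⟨V, Dm, Hm, dV, dD, dH⟩ := H i.k i.hk (Nat.one_le_pow i.k (ℓ + 1) (Nat.succ_pos ℓ)) i.a i.m2 i.ha1 i.ha2 i.hm1 i.hm2 i.Ω₀c i.Ωc hΩ₀ hΩ i.hsub
    i.Ac i.e he hle hreg
  have hn1 : 1 ≤ (ℓ + 1) ^ i.k := (Nat.one_le_pow i.k (ℓ + 1) (Nat.succ_pos ℓ))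
  have hnr : (0 : ℝ) < (((ℓ + 1) ^ i.k : ℕ) : ℝ) := by exact_mod_cast hn1
  -- the label-form `R₀` condition from `dist(x, Ω^c) ≥ R₀`
  have hRint : (0 : ℤ) ≤ (K : ℤ) * (d + 4) := by positivity
  have hlab : ∀ x : ↥(fineDom ((ℓ + 1) ^ i.k) i.Ωc), R₀ ≤ i.cdist x →
      ∀ y : Fin (d + 1) → ℤ, (∀ ν, |y ν - blk ((ℓ + 1) ^ i.k) x.1 ν| ≤ (K : ℤ) * (d + 4)) → y ∈ i.Ωc := by
    intro x hx y hy
    refine i.labels_of_cdist x hRint (le_trans (le_of_eq ?_) hx) y hy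
    rw [hR₀]; push_cast; try ring
  -- the exponential conversions (fine distances `n·D`)
  have hexp1 : ∀ {D : ℝ}, Real.exp (-((D * (((ℓ + 1) ^ i.k : ℕ) : ℝ)) / (4 * ((((ℓ + 1) ^ i.k : ℕ) : ℝ) * K)))) = Real.exp (-(δ₀ * D)) := by
    intro D
    congr 1
    rw [hδ₀]
    field_simp
  have hexp2 : ∀ D Db Df : ℝ, Real.exp (-((Db * (((ℓ + 1) ^ i.k : ℕ) : ℝ) + Df * (((ℓ + 1) ^ i.k : ℕ) : ℝ)) / (4 * ((((ℓ + 1) ^ i.k : ℕ) : ℝ) * K)))) *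
      Real.exp (-((D * (((ℓ + 1) ^ i.k : ℕ) : ℝ)) / (4 * ((((ℓ + 1) ^ i.k : ℕ) : ℝ) * K)))) = Real.exp (-(δ₀ * D)) * Real.exp (-(δ₀ * Db + δ₀ * Df)) := by
    intro D Db Df
    rw [← Real.exp_add, ← Real.exp_add]
    congr 1
    rw [hδ₀]
    field_simp
    ring
  -- sources: support, sup norm
  have hsrc : ∀ f : ↥(fineDom ((ℓ + 1) ^ i.k) i.Ωc) × ι → ℝ,
      (∀ p : ↥(fineDom ((ℓ + 1) ^ i.k) i.Ωc) × ι, ¬ (p.1 ∈ i.supp f) → f p = 0) ∧ ‖f‖ ≤ supN f :=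
    fun f => ⟨fun p hp => i.eq_zero_of_not_mem_supp f p hp, RegionPairInst.norm_le_supN f⟩
  -- the support of the extension and its distances
  have hsrcE : ∀ f : ↥(fineDom ((ℓ + 1) ^ i.k) i.Ωc) × ι → ℝ, ∀ p : ↥(fineDom ((ℓ + 1) ^ i.k) i.Ω₀c) × ι,
      ¬ (∃ z ∈ i.supp f, incl (Nat.one_le_pow i.k (ℓ + 1) (Nat.succ_pos ℓ)) i.hsub z = p.1) → i.extR f p = 0 := by
    rintro f ⟨p1, j⟩ hp
    by_cases hq : inReg ((ℓ + 1) ^ i.k) i.Ωc p1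
    · obtain ⟨z, hz⟩ := (B4RegionCubeCarrier.inReg_iff (Nat.one_le_pow i.k (ℓ + 1) (Nat.succ_pos ℓ)) i.hsub p1).1 hq
      have hzs : z ∉ i.supp f := fun h => hp ⟨z, h, hz⟩
      subst hz
      rw [i.extR_incl f z j]
      exact i.eq_zero_of_not_mem_supp f (z, j) hzs
    · exact i.extR_of_not_inReg f (p1, j) hq
  -- distances ↦ hypotheses of the members
  have hDs : ∀ (f : ↥(fineDom ((ℓ + 1) ^ i.k) i.Ωc) × ι → ℝ) (x : ↥(fineDom ((ℓ + 1) ^ i.k) i.Ωc)) (D : ℝ), D ≤ i.sdist1 x f →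
      ∀ x'', x'' ∈ i.supp f → ∃ μ, D * (((ℓ + 1) ^ i.k : ℕ) : ℝ) ≤ |rpos ((ℓ + 1) ^ i.k) i.Ωc x μ - rpos ((ℓ + 1) ^ i.k) i.Ωc x'' μ| :=
    fun f x D hD x'' hx'' => i.sdist1_coord x f hx'' hD
  have hDsE : ∀ (f : ↥(fineDom ((ℓ + 1) ^ i.k) i.Ωc) × ι → ℝ) (x : ↥(fineDom ((ℓ + 1) ^ i.k) i.Ωc)) (D : ℝ), D ≤ i.sdist1 x f →
      ∀ p : ↥(fineDom ((ℓ + 1) ^ i.k) i.Ω₀c), (∃ z ∈ i.supp f, incl (Nat.one_le_pow i.k (ℓ + 1) (Nat.succ_pos ℓ)) i.hsub z = p) →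
      ∃ μ, D * (((ℓ + 1) ^ i.k : ℕ) : ℝ) ≤ |rpos ((ℓ + 1) ^ i.k) i.Ω₀c (incl (Nat.one_le_pow i.k (ℓ + 1) (Nat.succ_pos ℓ)) i.hsub x) μ - rpos ((ℓ + 1) ^ i.k) i.Ω₀c p μ| := by
    intro f x D hD p hp
    obtain ⟨z, hz, rfl⟩ := hp
    exact i.sdist1_coord x f hz hD
  have hDb : ∀ (x : ↥(fineDom ((ℓ + 1) ^ i.k) i.Ωc)) (Db : ℝ), Db ≤ i.cdist x → ∀ x₁ : ↥(fineDom ((ℓ + 1) ^ i.k) i.Ω₀c),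
      ¬ inReg ((ℓ + 1) ^ i.k) i.Ωc x₁ → ∃ μ, Db * (((ℓ + 1) ^ i.k : ℕ) : ℝ) ≤ |rpos ((ℓ + 1) ^ i.k) i.Ω₀c (incl (Nat.one_le_pow i.k (ℓ + 1) (Nat.succ_pos ℓ)) i.hsub x) μ - rpos ((ℓ + 1) ^ i.k) i.Ω₀c x₁ μ| :=
    fun x Db hDb x₁ hx₁ => i.cdist_coord x hDb x₁ hx₁
  have hDf : ∀ (f : ↥(fineDom ((ℓ + 1) ^ i.k) i.Ωc) × ι → ℝ) (p : ↥(fineDom ((ℓ + 1) ^ i.k) i.Ω₀c)), (∃ z ∈ i.supp f, incl (Nat.one_le_pow i.k (ℓ + 1) (Nat.succ_pos ℓ)) i.hsub z = p) →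
      ∀ x₁ : ↥(fineDom ((ℓ + 1) ^ i.k) i.Ω₀c), ¬ inReg ((ℓ + 1) ^ i.k) i.Ωc x₁ →
      ∃ μ, i.bdistS f * (((ℓ + 1) ^ i.k : ℕ) : ℝ) ≤ |rpos ((ℓ + 1) ^ i.k) i.Ω₀c x₁ μ - rpos ((ℓ + 1) ^ i.k) i.Ω₀c p μ| := by
    intro f p hp x₁ hx₁
    obtain ⟨z, hz, rfl⟩ := hp
    obtain ⟨μ, hμ⟩ := i.cdist_coord z (i.bdistS_le f hz) x₁ hx₁
    exact ⟨μ, hμ.trans (le_of_eq (abs_sub_comm _ _))⟩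
  -- vector bounds from component bounds
  have hvec : ∀ (v : ι → ℝ) {b : ℝ}, 0 ≤ b → (∀ j, |v j| ≤ C * b) → siteNorm v ≤ c₀ * b := by
    intro v b hb hv
    refine (siteNorm_le_sqrt_card_mul v (by positivity) hv).trans ?_
    rw [← mul_assoc]
    exact mul_le_mul_of_nonneg_right hNC hb
  have hvecw : ∀ (w : ℝ) (v : ι → ℝ) {b : ℝ}, 0 ≤ w → 0 ≤ b → (∀ j, w * |v j| ≤ C * b) → w * siteNorm v ≤ c₀ * b := by
    intro w v b hw hb hv
    have : w * siteNorm v = siteNorm (w • v) := by rw [siteNorm_smul, abs_of_nonneg hw]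
    rw [this]
    refine hvec (w • v) hb fun j => ?_
    rw [Pi.smul_apply, smul_eq_mul, abs_mul, abs_of_nonneg hw]
    exact hv j
  dsimp only [Ineq19_110, Ineq111_112, regionPairFam]
  refine ⟨⟨?_, ?_⟩, ⟨?_, ?_⟩⟩
  ---------------------------------------------------------------- (1.9) on `Ω`
  · intro μ f x x' hR
    rcases hR with hR | hR
    · exact hR.elim
    obtain ⟨hfP, hφ⟩ := hsrc f
    clear V Dm dV dD dH
    show i.holderQ F α μ (i.DΩ F μ *ᵥ (i.GΩ F *ᵥ f)) x x'
      ≤ c₀ * Real.exp (-(δ₀ * min (i.sdist1 x f) (i.sdist1 x' f))) * supN f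
    have hD0 : 0 ≤ min (i.sdist1 x f) (i.sdist1 x' f) := le_min (i.sdist1_nonneg x f) (i.sdist1_nonneg x' f)
    have hb0 : 0 ≤ Real.exp (-(δ₀ * min (i.sdist1 x f) (i.sdist1 x' f))) * supN f :=
      mul_nonneg (Real.exp_pos _).le (supN_nonneg f)
    refine i.holderQ_le F (mul_nonneg (mul_nonneg hc₀0.le (Real.exp_pos _).le) (supN_nonneg f)) fun l hl => ?_
    obtain ⟨hx, hx', hne, hch, hend, hlen, hnear⟩ := hl
    have hw0 : 0 ≤ i.wt α x x' := Real.rpow_nonneg (div_nonneg hnr.le (supNorm_nonneg _)) α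
    have := hvecw (i.wt α x x') _ hw0 hb0 fun j => by
      have h := Hm μ x x' hx hx' hne l hch hend hlen hnear (hlab x (hR.trans (min_le_left _ _)))
        (hlab x' (hR.trans (min_le_right _ _))) (fun z => z ∈ i.supp f)
        (min (i.sdist1 x f) (i.sdist1 x' f) * (((ℓ + 1) ^ i.k : ℕ) : ℝ)) (mul_nonneg hD0 hnr.le)
        (hDs f x _ (min_le_left _ _)) (hDs f x' _ (min_le_right _ _)) f hfP j
      rw [hexp1] at h
      calc i.wt α x x' * |(transport (fieldLink F i.κ (acBond i.Ωc i.Ac)) x l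
              *ᵥ fld (i.DΩ F μ *ᵥ (i.GΩ F *ᵥ f)) x' - fld (i.DΩ F μ *ᵥ (i.GΩ F *ᵥ f)) x) j|
          ≤ C * Real.exp (-(δ₀ * min (i.sdist1 x f) (i.sdist1 x' f))) * ‖f‖ := h
        _ ≤ C * (Real.exp (-(δ₀ * min (i.sdist1 x f) (i.sdist1 x' f))) * supN f) := by
            rw [mul_assoc]; exact mul_le_mul_of_nonneg_left (mul_le_mul_of_nonneg_left hφ (Real.exp_pos _).le) hC.le
    calc i.wt α x x' * siteNorm (transport (fieldLink F i.κ (acBond i.Ωc i.Ac)) x l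
            *ᵥ fld (i.DΩ F μ *ᵥ (i.GΩ F *ᵥ f)) x' - fld (i.DΩ F μ *ᵥ (i.GΩ F *ᵥ f)) x)
        ≤ c₀ * (Real.exp (-(δ₀ * min (i.sdist1 x f) (i.sdist1 x' f))) * supN f) := this
      _ = c₀ * Real.exp (-(δ₀ * min (i.sdist1 x f) (i.sdist1 x' f))) * supN f := by ring
  ---------------------------------------------------------------- (1.10) on `Ω`
  · intro μ f x hR
    rcases hR with hR | hR
    · exact hR.elim
    obtain ⟨hfP, hφ⟩ := hsrc f
    clear Hm dV dD dH
    have hD0 : 0 ≤ i.sdist1 x f := i.sdist1_nonneg x f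
    have hb0 : 0 ≤ Real.exp (-(δ₀ * i.sdist1 x f)) * supN f := mul_nonneg (Real.exp_pos _).le (supN_nonneg f)
    have hR0 : 0 ≤ c₀ * Real.exp (-(δ₀ * i.sdist1 x f)) * supN f :=
      mul_nonneg (mul_nonneg hc₀0.le (Real.exp_pos _).le) (supN_nonneg f)
    refine ⟨?_, ?_⟩
    · show siteNorm (fld (i.DΩ F μ *ᵥ (i.GΩ F *ᵥ f)) x) ≤ c₀ * Real.exp (-(δ₀ * i.sdist1 x f)) * supN f
      by_cases hx : x.1 + e1 μ ∈ fineDom ((ℓ + 1) ^ i.k) i.Ωc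
      · have := hvec (fld (i.DΩ F μ *ᵥ (i.GΩ F *ᵥ f)) x) hb0 fun j => by
          rw [fld_apply]
          have h := Dm μ x hx (hlab x hR) (fun z => z ∈ i.supp f) (i.sdist1 x f * (((ℓ + 1) ^ i.k : ℕ) : ℝ))
            (mul_nonneg hD0 hnr.le) (hDs f x _ le_rfl) f hfP j
          rw [hexp1] at h
          calc |(i.DΩ F μ *ᵥ (i.GΩ F *ᵥ f)) (x, j)| ≤ C * Real.exp (-(δ₀ * i.sdist1 x f)) * ‖f‖ := h
            _ ≤ C * (Real.exp (-(δ₀ * i.sdist1 x f)) * supN f) := by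
                rw [mul_assoc]; exact mul_le_mul_of_nonneg_left (mul_le_mul_of_nonneg_left hφ (Real.exp_pos _).le) hC.le
        calc siteNorm (fld (i.DΩ F μ *ᵥ (i.GΩ F *ᵥ f)) x) ≤ c₀ * (Real.exp (-(δ₀ * i.sdist1 x f)) * supN f) := this
          _ = c₀ * Real.exp (-(δ₀ * i.sdist1 x f)) * supN f := by ring
      · rw [i.fld_DΩ_eq_zero F μ _ x hx, siteNorm_zero]
        exact hR0
    · show siteNorm (fld (i.GΩ F *ᵥ f) x) ≤ c₀ * Real.exp (-(δ₀ * i.sdist1 x f)) * supN f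
      have := hvec (fld (i.GΩ F *ᵥ f) x) hb0 fun j => by
        rw [fld_apply]
        have h := V x (hlab x hR) (fun z => z ∈ i.supp f) (i.sdist1 x f * (((ℓ + 1) ^ i.k : ℕ) : ℝ))
          (mul_nonneg hD0 hnr.le) (hDs f x _ le_rfl) f hfP j
        rw [hexp1] at h
        calc |(i.GΩ F *ᵥ f) (x, j)| ≤ C * Real.exp (-(δ₀ * i.sdist1 x f)) * ‖f‖ := h
          _ ≤ C * (Real.exp (-(δ₀ * i.sdist1 x f)) * supN f) := by
              rw [mul_assoc]; exact mul_le_mul_of_nonneg_left (mul_le_mul_of_nonneg_left hφ (Real.exp_pos _).le) hC.le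
      calc siteNorm (fld (i.GΩ F *ᵥ f) x) ≤ c₀ * (Real.exp (-(δ₀ * i.sdist1 x f)) * supN f) := this
        _ = c₀ * Real.exp (-(δ₀ * i.sdist1 x f)) * supN f := by ring
  ---------------------------------------------------------------- (1.9)·(1.12) for `δG`
  · intro μ f x x' hR
    rcases hR with hR | hR
    · exact hR.elim
    obtain ⟨hfP, hφ⟩ := hsrc f
    have hφE : ‖i.extR f‖ ≤ supN f := (i.norm_extR_le f).trans hφ
    have hres : (fun q : ↥(fineDom ((ℓ + 1) ^ i.k) i.Ωc) × ι => i.extR f (incl (Nat.one_le_pow i.k (ℓ + 1) (Nat.succ_pos ℓ)) i.hsub q.1, q.2)) = f :=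
      i.resR_extR f
    clear V Dm Hm dV dD
    show i.holderQ F α μ (i.DΩ F μ *ᵥ i.deltaV F f) x x'
      ≤ c₀ * Real.exp (-(δ₀ * min (i.sdist1 x f) (i.sdist1 x' f)))
        * Real.exp (-(δ₀ * min (i.cdist x) (i.cdist x') + δ₀ * i.bdistS f)) * supN f
    have hD0 : 0 ≤ min (i.sdist1 x f) (i.sdist1 x' f) := le_min (i.sdist1_nonneg x f) (i.sdist1_nonneg x' f)
    have hDb0 : 0 ≤ min (i.cdist x) (i.cdist x') := le_min (i.cdist_nonneg x) (i.cdist_nonneg x')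
    have hDf0 : 0 ≤ i.bdistS f := i.bdistS_nonneg f
    have hb0 : 0 ≤ Real.exp (-((min (i.cdist x) (i.cdist x') * (((ℓ + 1) ^ i.k : ℕ) : ℝ) + i.bdistS f * (((ℓ + 1) ^ i.k : ℕ) : ℝ)) / (4 * ((((ℓ + 1) ^ i.k : ℕ) : ℝ) * K)))) *
        Real.exp (-((min (i.sdist1 x f) (i.sdist1 x' f) * (((ℓ + 1) ^ i.k : ℕ) : ℝ)) / (4 * ((((ℓ + 1) ^ i.k : ℕ) : ℝ) * K)))) * supN f :=
      mul_nonneg (mul_nonneg (Real.exp_pos _).le (Real.exp_pos _).le) (supN_nonneg f)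
    rw [show c₀ * Real.exp (-(δ₀ * min (i.sdist1 x f) (i.sdist1 x' f)))
          * Real.exp (-(δ₀ * min (i.cdist x) (i.cdist x') + δ₀ * i.bdistS f)) * supN f
        = c₀ * (Real.exp (-((min (i.cdist x) (i.cdist x') * (((ℓ + 1) ^ i.k : ℕ) : ℝ) + i.bdistS f * (((ℓ + 1) ^ i.k : ℕ) : ℝ)) / (4 * ((((ℓ + 1) ^ i.k : ℕ) : ℝ) * K)))) *
        Real.exp (-((min (i.sdist1 x f) (i.sdist1 x' f) * (((ℓ + 1) ^ i.k : ℕ) : ℝ)) / (4 * ((((ℓ + 1) ^ i.k : ℕ) : ℝ) * K)))) * supN f) by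
          rw [hexp2]; ring]
    refine i.holderQ_le F (mul_nonneg hc₀0.le hb0) fun l hl => ?_
    obtain ⟨hx, hx', hne, hch, hend, hlen, hnear⟩ := hl
    have hw0 : 0 ≤ i.wt α x x' := Real.rpow_nonneg (div_nonneg hnr.le (supNorm_nonneg _)) α
    refine hvecw (i.wt α x x') _ hw0 hb0 fun j => ?_
    have h := dH μ x x' hx hx' hne l hch hend hlen hnear (hlab x (hR.trans (min_le_left _ _)))
      (hlab x' (hR.trans (min_le_right _ _))) (fun p => ∃ z ∈ i.supp f, incl (Nat.one_le_pow i.k (ℓ + 1) (Nat.succ_pos ℓ)) i.hsub z = p)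
      (min (i.sdist1 x f) (i.sdist1 x' f) * (((ℓ + 1) ^ i.k : ℕ) : ℝ))
      (min (i.cdist x) (i.cdist x') * (((ℓ + 1) ^ i.k : ℕ) : ℝ)) (i.bdistS f * (((ℓ + 1) ^ i.k : ℕ) : ℝ))
      (mul_nonneg hD0 hnr.le) (mul_nonneg hDb0 hnr.le) (mul_nonneg hDf0 hnr.le)
      (hDsE f x _ (min_le_left _ _)) (hDsE f x' _ (min_le_right _ _)) (hDb x _ (min_le_left _ _))
      (hDb x' _ (min_le_right _ _)) (hDf f) (i.extR f) (hsrcE f) j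
    rw [hres] at h
    have hid : ∀ z : ↥(fineDom ((ℓ + 1) ^ i.k) i.Ωc), z.1 + e1 μ ∈ fineDom ((ℓ + 1) ^ i.k) i.Ωc →
        fld (i.DΩ F μ *ᵥ i.deltaV F f) z = fld (i.DΩ F μ *ᵥ (i.GΩ F *ᵥ f)) z
          - fld (i.D₀ F μ *ᵥ (i.G₀ F *ᵥ i.extR f)) (incl (Nat.one_le_pow i.k (ℓ + 1) (Nat.succ_pos ℓ)) i.hsub z) := by
      intro z hz; funext j'; rw [Pi.sub_apply, i.fld_DΩ_deltaV_apply F μ f z hz j']; rfl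
    rw [hid x hx, hid x' hx', Matrix.mulVec_sub]
    have halg : transport (fieldLink F i.κ (acBond i.Ωc i.Ac)) x l *ᵥ fld (i.DΩ F μ *ᵥ (i.GΩ F *ᵥ f)) x'
          - transport (fieldLink F i.κ (acBond i.Ωc i.Ac)) x l *ᵥ fld (i.D₀ F μ *ᵥ (i.G₀ F *ᵥ i.extR f))
              (incl (Nat.one_le_pow i.k (ℓ + 1) (Nat.succ_pos ℓ)) i.hsub x')
          - (fld (i.DΩ F μ *ᵥ (i.GΩ F *ᵥ f)) x - fld (i.D₀ F μ *ᵥ (i.G₀ F *ᵥ i.extR f)) (incl (Nat.one_le_pow i.k (ℓ + 1) (Nat.succ_pos ℓ)) i.hsub x))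
        = transport (fieldLink F i.κ (acBond i.Ωc i.Ac)) x l *ᵥ fld (i.DΩ F μ *ᵥ (i.GΩ F *ᵥ f)) x'
          - fld (i.DΩ F μ *ᵥ (i.GΩ F *ᵥ f)) x
          - (transport (fieldLink F i.κ (acBond i.Ωc i.Ac)) x l *ᵥ fld (i.D₀ F μ *ᵥ (i.G₀ F *ᵥ i.extR f))
              (incl (Nat.one_le_pow i.k (ℓ + 1) (Nat.succ_pos ℓ)) i.hsub x') - fld (i.D₀ F μ *ᵥ (i.G₀ F *ᵥ i.extR f)) (incl (Nat.one_le_pow i.k (ℓ + 1) (Nat.succ_pos ℓ)) i.hsub x)) := by abel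
    rw [halg]
    refine h.trans ?_
    rw [mul_assoc C, mul_assoc C]
    exact mul_le_mul_of_nonneg_left (mul_le_mul_of_nonneg_left hφE (by positivity)) hC.le
  ---------------------------------------------------------------- (1.10)·(1.12) for `δG`
  · intro μ f x hR
    rcases hR with hR | hR
    · exact hR.elim
    obtain ⟨hfP, hφ⟩ := hsrc f
    have hφE : ‖i.extR f‖ ≤ supN f := (i.norm_extR_le f).trans hφ
    have hres : (fun q : ↥(fineDom ((ℓ + 1) ^ i.k) i.Ωc) × ι => i.extR f (incl (Nat.one_le_pow i.k (ℓ + 1) (Nat.succ_pos ℓ)) i.hsub q.1, q.2)) = f :=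
      i.resR_extR f
    clear V Dm Hm dH
    have hD0 : 0 ≤ i.sdist1 x f := i.sdist1_nonneg x f
    have hDb0 : 0 ≤ i.cdist x := i.cdist_nonneg x
    have hDf0 : 0 ≤ i.bdistS f := i.bdistS_nonneg f
    have hb0 : 0 ≤ Real.exp (-((i.cdist x * (((ℓ + 1) ^ i.k : ℕ) : ℝ) + i.bdistS f * (((ℓ + 1) ^ i.k : ℕ) : ℝ)) / (4 * ((((ℓ + 1) ^ i.k : ℕ) : ℝ) * K)))) *
        Real.exp (-((i.sdist1 x f * (((ℓ + 1) ^ i.k : ℕ) : ℝ)) / (4 * ((((ℓ + 1) ^ i.k : ℕ) : ℝ) * K)))) * supN f :=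
      mul_nonneg (mul_nonneg (Real.exp_pos _).le (Real.exp_pos _).le) (supN_nonneg f)
    have hRHS : c₀ * Real.exp (-(δ₀ * i.sdist1 x f)) * Real.exp (-(δ₀ * i.cdist x + δ₀ * i.bdistS f)) * supN f
        = c₀ * (Real.exp (-((i.cdist x * (((ℓ + 1) ^ i.k : ℕ) : ℝ) + i.bdistS f * (((ℓ + 1) ^ i.k : ℕ) : ℝ)) / (4 * ((((ℓ + 1) ^ i.k : ℕ) : ℝ) * K)))) *
          Real.exp (-((i.sdist1 x f * (((ℓ + 1) ^ i.k : ℕ) : ℝ)) / (4 * ((((ℓ + 1) ^ i.k : ℕ) : ℝ) * K)))) * supN f) := by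
      rw [hexp2]; ring
    have hfin : ∀ {t : ℝ}, t ≤ C * Real.exp (-((i.cdist x * (((ℓ + 1) ^ i.k : ℕ) : ℝ) + i.bdistS f * (((ℓ + 1) ^ i.k : ℕ) : ℝ)) / (4 * ((((ℓ + 1) ^ i.k : ℕ) : ℝ) * K)))) *
        Real.exp (-((i.sdist1 x f * (((ℓ + 1) ^ i.k : ℕ) : ℝ)) / (4 * ((((ℓ + 1) ^ i.k : ℕ) : ℝ) * K)))) * ‖i.extR f‖ →
        t ≤ C * (Real.exp (-((i.cdist x * (((ℓ + 1) ^ i.k : ℕ) : ℝ) + i.bdistS f * (((ℓ + 1) ^ i.k : ℕ) : ℝ)) / (4 * ((((ℓ + 1) ^ i.k : ℕ) : ℝ) * K)))) *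
        Real.exp (-((i.sdist1 x f * (((ℓ + 1) ^ i.k : ℕ) : ℝ)) / (4 * ((((ℓ + 1) ^ i.k : ℕ) : ℝ) * K)))) * supN f) := by
      intro t ht
      refine ht.trans ?_
      rw [mul_assoc C, mul_assoc C]
      exact mul_le_mul_of_nonneg_left (mul_le_mul_of_nonneg_left hφE (by positivity)) hC.le
    refine ⟨?_, ?_⟩
    · show siteNorm (fld (i.DΩ F μ *ᵥ i.deltaV F f) x)
        ≤ c₀ * Real.exp (-(δ₀ * i.sdist1 x f)) * Real.exp (-(δ₀ * i.cdist x + δ₀ * i.bdistS f)) * supN f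
      rw [hRHS]
      by_cases hx : x.1 + e1 μ ∈ fineDom ((ℓ + 1) ^ i.k) i.Ωc
      · refine hvec _ hb0 fun j => ?_
        have h := dD μ x hx (hlab x hR) (fun p => ∃ z ∈ i.supp f, incl (Nat.one_le_pow i.k (ℓ + 1) (Nat.succ_pos ℓ)) i.hsub z = p)
          (i.sdist1 x f * (((ℓ + 1) ^ i.k : ℕ) : ℝ)) (i.cdist x * (((ℓ + 1) ^ i.k : ℕ) : ℝ))
          (i.bdistS f * (((ℓ + 1) ^ i.k : ℕ) : ℝ)) (mul_nonneg hD0 hnr.le) (mul_nonneg hDb0 hnr.le)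
          (mul_nonneg hDf0 hnr.le) (hDsE f x _ le_rfl) (hDb x _ le_rfl) (hDf f)
          (i.extR f) (hsrcE f) j
        rw [hres] at h
        rw [i.fld_DΩ_deltaV_apply F μ f x hx j]
        exact hfin h
      · rw [i.fld_DΩ_eq_zero F μ _ x hx, siteNorm_zero]
        exact mul_nonneg hc₀0.le hb0
    · show siteNorm (fld (i.deltaV F f) x)
        ≤ c₀ * Real.exp (-(δ₀ * i.sdist1 x f)) * Real.exp (-(δ₀ * i.cdist x + δ₀ * i.bdistS f)) * supN f
      rw [hRHS]
      refine hvec _ hb0 fun j => ?_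
      have h := dV x (hlab x hR) (fun p => ∃ z ∈ i.supp f, incl (Nat.one_le_pow i.k (ℓ + 1) (Nat.succ_pos ℓ)) i.hsub z = p)
        (i.sdist1 x f * (((ℓ + 1) ^ i.k : ℕ) : ℝ)) (i.cdist x * (((ℓ + 1) ^ i.k : ℕ) : ℝ))
        (i.bdistS f * (((ℓ + 1) ^ i.k : ℕ) : ℝ)) (mul_nonneg hD0 hnr.le) (mul_nonneg hDb0 hnr.le)
        (mul_nonneg hDf0 hnr.le) (hDsE f x _ le_rfl) (hDb x _ le_rfl) (hDf f)
        (i.extR f) (hsrcE f) j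
      rw [hres] at h
      rw [i.fld_deltaV_apply F f x j]
      exact hfin h

/-! ## §3. The torus region-pair family (NODE 00's `famE` of record for N01): r01 g9's lifting assembly in the same order -/

section Torus

open LiftData

variable {d : ℕ}

/-- **THEOREM p. 573 IN THE PRINT'S QUANTIFIER ORDER ON THE FAMILY OF TORUS REGION PAIRS `Ω ⊂ Ω₀ ⊂ T_η` AT A
(1.7)-REGULAR TORUS FIELD** (`torusPairFam`, block size `K = Kmod`; p. 572 «Another common case is to consider operators
on subsets of a torus T_η»): there are `δ₀, R₀ > 0` — the lattice family's `(4K)⁻¹` and `K(d+4) + 2`, chosen before `α` —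
such that for every `0 ≤ α < 1` there are `c₀, e₁ > 0` (the lattice `e₁(α)` and `4(d+1)·c₀(α)`) with
`Ineq19_110 ∧ Ineq111_112` at `(α, δ₀, c₀, R₀)` for every instance whose torus field is (1.7)-regular on `Ω₀`, whose
`Ω, Ω₀, T_η` are unions of `K`-blocks and whose coupling is `0 < e ≤ e₁` (for `Ω = T_η` without the `R₀` restriction).
Proof = r01 g9's `thmPrintedNN_torusPairFam` — the six lifting members `lhs19_torus`, `valDG_torus`, `valG_torus`,
`dlhs19_torus`, `dvalDG_torus`, `dvalG_torus` BY NAME — fed with §2 instead of `thmPrintedNN_regionPairFam`.  At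
`F := θ.F`, `d := θ.D − 1`, `ℓ := θ.L − 1`, `(a₋, a₊, m²₊, c, β) := θ`'s, this family IS `(Node00.carriers₁ θ X).famE`
(`Node00.CarriersFrame.carriers₁_groupB4`, `rfl`). [cite: Balaban1983RegularityDecay, Theorem (1.9)–(1.12) p.573 «depending on d, M only, c₀ on α also», p.572 «operators on subsets of a torus T_η»] -/
theorem thmPrintedNNUnif_torusPairFam (F : OrthFlow ι) {ℓ₁ : ℝ} (hℓ₁ : 0 ≤ ℓ₁)
    (hLip : ∀ t (v : ι → ℝ), ((F.U t - 1) *ᵥ v) ⬝ᵥ ((F.U t - 1) *ᵥ v) ≤ (ℓ₁ * t) ^ 2 * (v ⬝ᵥ v))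
    (d ℓ : ℕ) (hℓ : 1 ≤ ℓ) (amin aplus m2plus : ℝ) (ha : 0 < amin) (creg β : ℝ) (hcreg : 0 ≤ creg)
    (hβ : 0 < β) :
    ThmPrintedNNUnif
      (torusPairFam F d ℓ amin aplus m2plus creg β (Kmod F hℓ₁ hLip d ℓ hℓ amin aplus m2plus ha)) := by
  have HU := thmPrintedNNUnif_regionPairFam F hℓ₁ hLip d ℓ hℓ amin aplus m2plus ha creg β hcreg hβ
  unfold ThmPrintedNNUnif at HU ⊢
  obtain ⟨δ₀, R₀, hδ, hR₀, HU⟩ := HU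
  have hK16 : 16 ≤ Kmod F hℓ₁ hLip d ℓ hℓ amin aplus m2plus ha :=
    (Classical.choose_spec (region_pair_members F hℓ₁ hLip d ℓ hℓ amin aplus m2plus ha)).1
  have hK1 : 1 ≤ Kmod F hℓ₁ hLip d ℓ hℓ amin aplus m2plus ha := le_trans (by norm_num) hK16
  have hd : (0 : ℝ) ≤ d := Nat.cast_nonneg d
  refine ⟨δ₀, R₀, hδ, hR₀, fun α hα0 hα1 => ?_⟩
  obtain ⟨c₀, e₁, hc, he₁, H⟩ := HU α hα0 hα1
  refine ⟨4 * ((d : ℝ) + 1) * c₀, e₁, by positivity, he₁, ?_⟩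
  intro i hreg hbig he hle
  have HI : ∀ R : ℕ,
      Ineq19_110 (regionPairFam F d ℓ amin aplus m2plus creg β (Kmod F hℓ₁ hLip d ℓ hℓ amin aplus m2plus ha)
        (i.liftInst R)) α δ₀ c₀ R₀ ∧
      Ineq111_112 (regionPairFam F d ℓ amin aplus m2plus creg β (Kmod F hℓ₁ hLip d ℓ hℓ amin aplus m2plus ha)
        (i.liftInst R)) α δ₀ c₀ R₀ :=
    fun R => H (i.liftInst R) (i.regular_lift F R hreg) (i.bigBlocks_lift F hK1 R hbig) he hle
  have HI' : ∀ R : ℕ,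
      Ineq19_110 (regionPairFam F d ℓ amin aplus m2plus creg β (Kmod F hℓ₁ hLip d ℓ hℓ amin aplus m2plus ha)
        (i.liftInst R)) α δ₀ c₀ R₀ := fun R => (HI R).1
  have HI₀ : ∀ R : ℕ,
      Ineq19_110 (regionPairFam F d ℓ amin aplus m2plus creg β (Kmod F hℓ₁ hLip d ℓ hℓ amin aplus m2plus ha)
        (i.liftInst₀ R)) α δ₀ c₀ R₀ :=
    fun R => (H (i.liftInst₀ R) (i.regular_lift₀ F R hreg) (i.bigBlocks_lift₀ F hK1 R hbig) he hle).1
  have he' : 0 < i.e := he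
  have hc4 : c₀ ≤ 4 * ((d : ℝ) + 1) * c₀ := by nlinarith
  have hw1 : ∀ {E s : ℝ}, 0 ≤ E → 0 ≤ s → c₀ * E * s ≤ 4 * ((d : ℝ) + 1) * c₀ * E * s :=
    fun hE hs => mul_le_mul_of_nonneg_right (mul_le_mul_of_nonneg_right hc4 hE) hs
  have hw2 : ∀ {E E' s : ℝ}, 0 ≤ E → 0 ≤ E' → 0 ≤ s → c₀ * E * E' * s ≤ 4 * ((d : ℝ) + 1) * c₀ * E * E' * s :=
    fun hE hE' hs => mul_le_mul_of_nonneg_right (mul_le_mul_of_nonneg_right (mul_le_mul_of_nonneg_right hc4 hE) hE') hs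
  refine ⟨⟨fun μ f x x' hxx => ?_, fun μ f x hx1 => ⟨?_, ?_⟩⟩, ⟨fun μ f x x' hxx => ?_, fun μ f x hx1 => ⟨?_, ?_⟩⟩⟩
  · exact lhs19_torus i F ha hℓ hδ hc hα0 hα1.le HI' μ f x x' hxx
  · exact (valDG_torus i F ha hℓ hδ hc HI' μ f x hx1).trans (hw1 (Real.exp_pos _).le (supN_nonneg _))
  · exact (valG_torus i F ha hℓ hδ hc HI' f x hx1).trans (hw1 (Real.exp_pos _).le (supN_nonneg _))
  · exact dlhs19_torus i F ha hℓ hδ hc hα0 hα1.le HI HI₀ μ f x x' hxx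
  · exact (dvalDG_torus i F ha hℓ hδ hc HI HI₀ μ f x hx1).trans
      (hw2 (Real.exp_pos _).le (Real.exp_pos _).le (supN_nonneg _))
  · exact (dvalG_torus i F ha hℓ hδ hc HI HI₀ f x hx1).trans
      (hw2 (Real.exp_pos _).le (Real.exp_pos _).le (supN_nonneg _))

end Torus

/-! ## §4. The uniform form is closed under binary joins of families and restricts to the summands -/

section Join

/-- **THE UNIFORM FORM IS CLOSED UNDER JOINS OF FAMILIES**: if `ThmPrintedNNUnif` holds on two families whose distance
and sup-norm functionals are non-negative, it holds on `Sum.elim fam₁ fam₂` — `δ₀ = min`, `R₀ = max` of the two pairs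
(still before `α`), and for each `α` `c₀ = max`, `e₁ = min`; by dag-p3 g2's monotonicity lemmas `ineq19_110_mono` ∕
`ineq111_112_mono`. [cite: Balaban1983RegularityDecay, Theorem (1.9)–(1.12) p.573 «constants δ₀, c₀, R₀ independent of A, k, Ω» (bookkeeping: one pair (δ₀, R₀) for a union of instance families)] -/
theorem thmPrintedNNUnif_sumElim {I₁ I₂ : Type} (fam₁ : I₁ → EtaSetting) (fam₂ : I₂ → EtaSetting)
    (hsg₁ : ∀ i, (∀ x f, 0 ≤ (fam₁ i).sdist1 x f) ∧ (∀ x x' f, 0 ≤ (fam₁ i).sdist2 x x' f) ∧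
      (∀ x, 0 ≤ (fam₁ i).bdist1 x) ∧ (∀ x x', 0 ≤ (fam₁ i).bdist2 x x') ∧ (∀ f, 0 ≤ (fam₁ i).bdistS f) ∧
      (∀ f, 0 ≤ (fam₁ i).supNorm f))
    (hsg₂ : ∀ i, (∀ x f, 0 ≤ (fam₂ i).sdist1 x f) ∧ (∀ x x' f, 0 ≤ (fam₂ i).sdist2 x x' f) ∧
      (∀ x, 0 ≤ (fam₂ i).bdist1 x) ∧ (∀ x x', 0 ≤ (fam₂ i).bdist2 x x') ∧ (∀ f, 0 ≤ (fam₂ i).bdistS f) ∧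
      (∀ f, 0 ≤ (fam₂ i).supNorm f))
    (h₁ : ThmPrintedNNUnif fam₁) (h₂ : ThmPrintedNNUnif fam₂) : ThmPrintedNNUnif (Sum.elim fam₁ fam₂) := by
  obtain ⟨δ₁, R₁, hδ₁, hR₁, H₁⟩ := h₁
  obtain ⟨δ₂, R₂, hδ₂, hR₂, H₂⟩ := h₂
  refine ⟨min δ₁ δ₂, max R₁ R₂, lt_min hδ₁ hδ₂, lt_max_of_lt_left hR₁, fun α hα0 hα1 => ?_⟩
  obtain ⟨c₁, e₁, hc₁, he₁, H₁'⟩ := H₁ α hα0 hα1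
  obtain ⟨c₂, e₂, hc₂, he₂, H₂'⟩ := H₂ α hα0 hα1
  refine ⟨max c₁ c₂, min e₁ e₂, lt_max_of_lt_left hc₁, lt_min he₁ he₂, ?_⟩
  rintro (i | i) hreg hbig he hle
  · obtain ⟨hs1, hs2, hb1, hb2, hbS, hN⟩ := hsg₁ i
    obtain ⟨hA, hB⟩ := H₁' i hreg hbig he (hle.trans (min_le_left _ _))
    exact ⟨ineq19_110_mono (fam₁ i) (min_le_left _ _) (le_max_left _ _) hc₁.le (le_max_left _ _) hs1 hs2 hN hA,
      ineq111_112_mono (fam₁ i) (min_le_left _ _) (le_max_left _ _) hc₁.le (le_max_left _ _) hs1 hs2 hb1 hb2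
        hbS hN hB⟩
  · obtain ⟨hs1, hs2, hb1, hb2, hbS, hN⟩ := hsg₂ i
    obtain ⟨hA, hB⟩ := H₂' i hreg hbig he (hle.trans (min_le_right _ _))
    exact ⟨ineq19_110_mono (fam₂ i) (min_le_right _ _) (le_max_right _ _) hc₂.le (le_max_right _ _) hs1 hs2 hN
        hA,
      ineq111_112_mono (fam₂ i) (min_le_right _ _) (le_max_right _ _) hc₂.le (le_max_right _ _) hs1 hs2 hb1
        hb2 hbS hN hB⟩

/-- restriction of the uniform form from a join to its left summand (no sign hypothesis). [cite: Balaban1983RegularityDecay, Theorem p.573 (bookkeeping)] -/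
theorem thmPrintedNNUnif_of_sumElim_left {I₁ I₂ : Type} (fam₁ : I₁ → EtaSetting) (fam₂ : I₂ → EtaSetting)
    (h : ThmPrintedNNUnif (Sum.elim fam₁ fam₂)) : ThmPrintedNNUnif fam₁ := by
  obtain ⟨δ₀, R₀, hδ, hR, H⟩ := h
  refine ⟨δ₀, R₀, hδ, hR, fun α hα0 hα1 => ?_⟩
  obtain ⟨c₀, e₁, hc, he, H'⟩ := H α hα0 hα1
  exact ⟨c₀, e₁, hc, he, fun i => H' (Sum.inl i)⟩

/-- restriction of the uniform form from a join to its right summand (no sign hypothesis). [cite: Balaban1983RegularityDecay, Theorem p.573 (bookkeeping)] -/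
theorem thmPrintedNNUnif_of_sumElim_right {I₁ I₂ : Type} (fam₁ : I₁ → EtaSetting) (fam₂ : I₂ → EtaSetting)
    (h : ThmPrintedNNUnif (Sum.elim fam₁ fam₂)) : ThmPrintedNNUnif fam₂ := by
  obtain ⟨δ₀, R₀, hδ, hR, H⟩ := h
  refine ⟨δ₀, R₀, hδ, hR, fun α hα0 hα1 => ?_⟩
  obtain ⟨c₀, e₁, hc, he, H'⟩ := H α hα0 hα1
  exact ⟨c₀, e₁, hc, he, fun i => H' (Sum.inr i)⟩

variable (F : OrthFlow ι) {ℓ₁ : ℝ} (hℓ₁ : 0 ≤ ℓ₁)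
  (hLip : ∀ t (v : ι → ℝ), ((F.U t - 1) *ᵥ v) ⬝ᵥ ((F.U t - 1) *ᵥ v) ≤ (ℓ₁ * t) ^ 2 * (v ⬝ᵥ v))
  (d ℓ : ℕ) (hℓ : 1 ≤ ℓ) (amin aplus m2plus : ℝ) (ha : 0 < amin) (creg β : ℝ) (hcreg : 0 ≤ creg) (hβ : 0 < β)

include hcreg hβ in
/-- **BOTH PRINTED SETTINGS WITH ONE `(δ₀, R₀)` BEFORE `α`**: the uniform form on the join (lattice big-block pairs
`Ω ⊂ Ω₀ ⊂ ηℤ^{d+1}`, `R₀` live) ⊕ (torus pairs `Ω ⊂ Ω₀ ⊂ T_η`), from §2, §3 and dag-p3 g2's sign lemmas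
`regionPairFam_signs` ∕ `torusPairFam_signs`. [cite: Balaban1983RegularityDecay, Theorem (1.9)–(1.12) p.573, p.572 «Another common case is to consider operators on subsets of a torus T_η»] -/
theorem thmPrintedNNUnif_latticeTorusJoin :
    ThmPrintedNNUnif (Sum.elim
      (regionPairFam F d ℓ amin aplus m2plus creg β (Kmod F hℓ₁ hLip d ℓ hℓ amin aplus m2plus ha))
      (torusPairFam F d ℓ amin aplus m2plus creg β (Kmod F hℓ₁ hLip d ℓ hℓ amin aplus m2plus ha))) :=
  thmPrintedNNUnif_sumElim _ _ (fun i => regionPairFam_signs F d ℓ amin aplus m2plus creg β _ i)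
    (fun i => torusPairFam_signs F d ℓ amin aplus m2plus creg β _ i)
    (thmPrintedNNUnif_regionPairFam F hℓ₁ hLip d ℓ hℓ amin aplus m2plus ha creg β hcreg hβ)
    (thmPrintedNNUnif_torusPairFam F hℓ₁ hLip d ℓ hℓ amin aplus m2plus ha creg β hcreg hβ)

end Join

end

end Literature.MathematicalPhysics.QuantumFieldTheory.Balaban1983to89.B4ThmAlphaUniform
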